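import Mathlib
import Summits.Ventures.HodgeRepro.Cayley

/-!
# Real approximation for unitary groups of Hermitian forms over CM fields (matrix form)

Let `K` be a CM field (Mathlib `IsCMField`, `star = complexConj`), `φ₀ : K → ℂ` an embedding,
`H_K ∈ M_n(K)` Hermitian and invertible, `H := H_K.map φ₀`.  **`mem_closure_kUnitary`**: every
`H`-unitary complex matrix `g` (`gᴴ H g = H`) lies in the closure of the images `φ₀(g_K)` of the
`K`-points `g_K ∈ U(H_K)`.  Proof (no structure theory of algebraic groups, only the Cayley
transform of `Cayley.lean`):
1. `g` is a limit of the `H`-unitary matrices `e^{iθ} g`, `θ → 0`, with `det (1 + e^{iθ} g) ≠ 0`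
   (the exceptional `θ` near `0` are finitely many — `mem_closure_unitary_det_ne_zero`);
2. such a matrix is `cayley X` for the `H`-skew `X = cayleyInv g`; `X` is a limit of images of
   `H_K`-skew `K`-matrices `H_K⁻¹ ((Q - Qᵀ) + δ (R + Rᵀ))`, `Q, R` rational, `star δ = -δ`
   (`mem_closure_skew_kpoints`: `φ₀ δ` is purely imaginary, rational matrices are dense);
3. `cayley` is continuous at `X` and commutes with `φ₀`, so `cayley (Z.map φ₀) = (cayley Z).map φ₀`
   with `cayley Z ∈ U(H_K)` (`mem_closure_kUnitary_of_det_ne_zero`).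
The transfer to typer-2's `ratPointsOf ≤ U(p,1)` is `RealApproxUnitary.dense_ratPointsOf`.
-/

namespace HodgeRepro.Cayley

open Matrix

/-! ## Rational matrices are dense; `K`-points of the skew space are dense -/

section KPoints

open Filter Topology NumberField

variable {n : Type*}

/-- Rational matrices are dense in real matrices. -/
theorem denseRange_matrix_ratCast :
    DenseRange fun Q : Matrix n n ℚ => Q.map ((↑) : ℚ → ℝ) := by
  have h : DenseRange (Pi.map fun _ : n => Pi.map fun _ : n => ((↑) : ℚ → ℝ)) :=
    DenseRange.piMap fun _ => DenseRange.piMap fun _ => Rat.denseRange_cast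
  exact h

/-- Every real matrix is the limit of a sequence of rational matrices. -/
theorem exists_seq_ratCast_tendsto [Finite n] (A : Matrix n n ℝ) :
    ∃ Q : ℕ → Matrix n n ℚ, Tendsto (fun m => (Q m).map ((↑) : ℚ → ℝ)) atTop (𝓝 A) := by
  have hA : A ∈ closure (Set.range fun Q : Matrix n n ℚ => Q.map ((↑) : ℚ → ℝ)) :=
    denseRange_matrix_ratCast A
  haveI : FirstCountableTopology (Matrix n n ℝ) :=
    inferInstanceAs (FirstCountableTopology (n → n → ℝ))
  rw [mem_closure_iff_seq_limit] at hA
  obtain ⟨u, hu, hlim⟩ := hA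
  choose Q hQ using hu
  refine ⟨Q, ?_⟩
  have : (fun m => (Q m).map ((↑) : ℚ → ℝ)) = u := funext fun m => hQ m
  rw [this]
  exact hlim

/-- Lifting a convergent sequence of rational matrices to `ℂ`. -/
theorem tendsto_map_ratCast_complex {Q : ℕ → Matrix n n ℚ} {A : Matrix n n ℝ}
    (h : Tendsto (fun m => (Q m).map ((↑) : ℚ → ℝ)) atTop (𝓝 A)) :
    Tendsto (fun m => (Q m).map ((↑) : ℚ → ℂ)) atTop (𝓝 (A.map ((↑) : ℝ → ℂ))) := by
  have hc : Continuous fun M : Matrix n n ℝ => M.map ((↑) : ℝ → ℂ) :=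
    continuous_id.matrix_map Complex.continuous_ofReal
  refine ((hc.tendsto A).comp h).congr fun m => ?_
  simp only [Function.comp, Matrix.map_map]
  rfl

variable [Fintype n] [DecidableEq n] {K : Type*} [Field K] [NumberField K] [IsCMField K]

/-- An embedding `φ₀ : K → ℂ` intertwines the CM conjugation and complex conjugation. -/
theorem map_star_eq (φ₀ : K →+* ℂ) (x : K) : φ₀ (star x) = star (φ₀ x) := by
  show φ₀ (IsCMField.complexConj K x) = star (φ₀ x)
  rw [IsCMField.complexEmbedding_complexConj]
  rfl

omit [Fintype n] [DecidableEq n] in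
/-- `φ₀` commutes with the conjugate transpose. -/
theorem conjTranspose_map_emb (φ₀ : K →+* ℂ) (A : Matrix n n K) : Aᴴ.map φ₀ = (A.map φ₀)ᴴ :=
  Matrix.conjTranspose_map φ₀ fun x => map_star_eq φ₀ x

/-- A CM field has a non-zero element with `star δ = -δ`. -/
theorem exists_star_eq_neg : ∃ δ : K, star δ = -δ ∧ δ ≠ 0 := by
  obtain ⟨x, hx⟩ : ∃ x : K, star x ≠ x := by
    by_contra h
    push Not at h
    apply IsCMField.complexConj_ne_one K
    ext x
    exact h x
  refine ⟨x - star x, ?_, ?_⟩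
  · rw [star_sub, star_star]; abel
  · intro h
    rw [sub_eq_zero] at h
    exact hx h.symm

/-- The image of a `star`-anti-invariant element is purely imaginary: `φ₀ δ = r * I` with
`r = (φ₀ δ).im`. -/
theorem map_eq_im_mul_I (φ₀ : K →+* ℂ) {δ : K} (hδ : star δ = -δ) :
    φ₀ δ = ((φ₀ δ).im : ℂ) * Complex.I := by
  have h : star (φ₀ δ) = -(φ₀ δ) := by rw [← map_star_eq, hδ, map_neg]
  have hre : (φ₀ δ).re = 0 := by
    have := congrArg Complex.re h
    rw [Complex.star_def, Complex.conj_re, Complex.neg_re] at this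
    linarith
  apply Complex.ext
  · rw [hre]; simp
  · simp

omit [Fintype n] [DecidableEq n] in
/-- A rational matrix in `K` is `star`-fixed: its conjugate transpose is its transpose. -/
theorem conjTranspose_map_ratCast (Q : Matrix n n ℚ) :
    (Q.map ((↑) : ℚ → K))ᴴ = (Q.map ((↑) : ℚ → K))ᵀ := by
  ext i j
  simp only [conjTranspose_apply, Matrix.map_apply, transpose_apply, star_ratCast]

omit [Fintype n] [DecidableEq n] in
/-- The `K`-matrix `(Q - Qᵀ) + δ (R + Rᵀ)` (`Q, R` rational, `star δ = -δ`) is skew-Hermitian. -/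
theorem conjTranspose_skewK {δ : K} (hδ : star δ = -δ) (Q R : Matrix n n ℚ) :
    ((Q.map ((↑) : ℚ → K) - (Q.map ((↑) : ℚ → K))ᵀ) +
        δ • (R.map ((↑) : ℚ → K) + (R.map ((↑) : ℚ → K))ᵀ))ᴴ =
      -((Q.map ((↑) : ℚ → K) - (Q.map ((↑) : ℚ → K))ᵀ) +
        δ • (R.map ((↑) : ℚ → K) + (R.map ((↑) : ℚ → K))ᵀ)) := by
  ext i j
  simp only [conjTranspose_apply, Matrix.add_apply, Matrix.sub_apply, Matrix.smul_apply,
    transpose_apply, Matrix.map_apply, Matrix.neg_apply, star_add, star_sub, star_mul, star_ratCast,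
    smul_eq_mul, hδ]
  ring

/-- `HK⁻¹ M` is `HK`-skew when `M` is skew-Hermitian and `HK` is Hermitian and invertible. -/
theorem isSkew_inv_mul {HK : Matrix n n K} (hHK : HKᴴ = HK) (hdet : IsUnit HK.det)
    {M : Matrix n n K} (hM : Mᴴ = -M) : IsSkewFor HK (HK⁻¹ * M) := by
  unfold IsSkewFor
  have h1 : (HK⁻¹ * M)ᴴ * HK = Mᴴ := by
    rw [conjTranspose_mul, conjTranspose_nonsing_inv, hHK, Matrix.mul_assoc,
      nonsing_inv_mul _ hdet, mul_one]
  have h2 : HK * (HK⁻¹ * M) = M := by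
    rw [← Matrix.mul_assoc, mul_nonsing_inv _ hdet, one_mul]
  rw [h1, h2, hM, neg_add_cancel]

omit [NumberField K] [IsCMField K] in
/-- `φ₀` commutes with the matrix inverse of an invertible matrix. -/
theorem map_nonsing_inv (φ₀ : K →+* ℂ) {HK : Matrix n n K} (hdet : IsUnit HK.det) :
    (HK⁻¹).map φ₀ = (HK.map φ₀)⁻¹ := by
  symm
  apply inv_eq_left_inv
  rw [← Matrix.map_mul, nonsing_inv_mul _ hdet, Matrix.map_one _ (map_zero _) (map_one _)]

omit [Fintype n] [DecidableEq n] [IsCMField K] in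
/-- The image under `φ₀` of the skew `K`-matrix built from rational `Q, R`. -/
theorem map_skewK (φ₀ : K →+* ℂ) (δ : K) (Q R : Matrix n n ℚ) :
    ((Q.map ((↑) : ℚ → K) - (Q.map ((↑) : ℚ → K))ᵀ) +
        δ • (R.map ((↑) : ℚ → K) + (R.map ((↑) : ℚ → K))ᵀ)).map φ₀ =
      (Q.map ((↑) : ℚ → ℂ) - (Q.map ((↑) : ℚ → ℂ))ᵀ) +
        (φ₀ δ) • (R.map ((↑) : ℚ → ℂ) + (R.map ((↑) : ℚ → ℂ))ᵀ) := by
  ext i j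
  simp only [Matrix.map_apply, Matrix.add_apply, Matrix.sub_apply, Matrix.smul_apply,
    transpose_apply, smul_eq_mul, map_add, map_sub, map_mul, map_ratCast]

omit [Fintype n] [DecidableEq n] in
/-- For a skew-Hermitian complex matrix `S` and `r ≠ 0`: `S` is recovered from the real
antisymmetric part `A₁ = ½ re S` and the real symmetric part `B₁ = (2r)⁻¹ im S` as
`(A₁ - A₁ᵀ) + (r I) • (B₁ + B₁ᵀ)`. -/
theorem skew_eq_of_parts {S : Matrix n n ℂ} (hS : Sᴴ = -S) {r : ℝ} (hr : r ≠ 0) :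
    ((((1 / 2 : ℝ) • S.map Complex.re).map ((↑) : ℝ → ℂ)) -
        (((1 / 2 : ℝ) • S.map Complex.re).map ((↑) : ℝ → ℂ))ᵀ) +
      ((r : ℂ) * Complex.I) • ((((1 / (2 * r) : ℝ) • S.map Complex.im).map ((↑) : ℝ → ℂ)) +
        (((1 / (2 * r) : ℝ) • S.map Complex.im).map ((↑) : ℝ → ℂ))ᵀ) = S := by
  ext i j
  have hij : Sᴴ i j = (-S) i j := by rw [hS]
  simp only [conjTranspose_apply, Matrix.neg_apply, Complex.star_def] at hij
  have hre : (S j i).re = -(S i j).re := by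
    have := congrArg Complex.re hij; simpa using this
  have him : (S j i).im = (S i j).im := by
    have := congrArg Complex.im hij; simpa using this
  simp only [Matrix.add_apply, Matrix.sub_apply, Matrix.smul_apply, transpose_apply,
    Matrix.map_apply, smul_eq_mul, hre, him]
  apply Complex.ext
  · simp only [Complex.add_re, Complex.sub_re, Complex.ofReal_re, Complex.mul_re, Complex.I_re,
      Complex.I_im, Complex.ofReal_im, Complex.add_im, Complex.mul_im]
    ring
  · simp only [Complex.add_im, Complex.sub_im, Complex.ofReal_im, Complex.mul_im, Complex.I_re,
      Complex.I_im, Complex.ofReal_re, Complex.add_re, Complex.mul_re]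
    field_simp
    ring

/-- **The `K`-points of the Lie algebra are dense.** For `HK ∈ M_n(K)` Hermitian and invertible
and `H := HK.map φ₀`, every `H`-skew complex matrix is a limit of images `Z.map φ₀` of `HK`-skew
`K`-matrices `Z` (the skew-Hermitian `K`-matrices are `(Q - Qᵀ) + δ (R + Rᵀ)` with rational `Q, R`
and `star δ = -δ`, whose images `(Q - Qᵀ) + (r I)(R + Rᵀ)` are dense among the skew-Hermitian
complex matrices). -/
theorem mem_closure_skew_kpoints (φ₀ : K →+* ℂ) {HK : Matrix n n K} (hHK : HKᴴ = HK)
    (hdet : IsUnit HK.det) {Y : Matrix n n ℂ} (hY : IsSkewFor (HK.map φ₀) Y) :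
    Y ∈ closure {m : Matrix n n ℂ | ∃ Z : Matrix n n K, IsSkewFor HK Z ∧ m = Z.map φ₀} := by
  obtain ⟨δ, hδ, hδ0⟩ := exists_star_eq_neg (K := K)
  set r : ℝ := (φ₀ δ).im with hr
  have hφδ : φ₀ δ = (r : ℂ) * Complex.I := map_eq_im_mul_I φ₀ hδ
  have hr0 : r ≠ 0 := by
    intro h0
    apply hδ0
    apply φ₀.injective
    rw [map_zero, hφδ, h0, Complex.ofReal_zero, zero_mul]
  set H := HK.map φ₀ with hH
  have hHherm : Hᴴ = H := by rw [hH, ← conjTranspose_map_emb, hHK]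
  have hHdet : IsUnit H.det := by
    have : H.det = φ₀ HK.det := by rw [hH, ← RingHom.mapMatrix_apply, RingHom.map_det]
    rw [this]
    exact hdet.map φ₀
  set S := H * Y with hS
  have hSskew : Sᴴ = -S := by
    rw [hS, conjTranspose_mul, hHherm, hY.conjTranspose_mul]
  obtain ⟨Q, hQ⟩ := exists_seq_ratCast_tendsto ((1 / 2 : ℝ) • S.map Complex.re)
  obtain ⟨R, hR⟩ := exists_seq_ratCast_tendsto ((1 / (2 * r) : ℝ) • S.map Complex.im)
  set SK : ℕ → Matrix n n K := fun m =>
    ((Q m).map ((↑) : ℚ → K) - ((Q m).map ((↑) : ℚ → K))ᵀ) +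
      δ • ((R m).map ((↑) : ℚ → K) + ((R m).map ((↑) : ℚ → K))ᵀ) with hSK
  have hZ : ∀ m, IsSkewFor HK (HK⁻¹ * SK m) := fun m =>
    isSkew_inv_mul hHK hdet (conjTranspose_skewK hδ (Q m) (R m))
  -- the images converge to `H⁻¹ S = Y`
  have hQc := tendsto_map_ratCast_complex hQ
  have hRc := tendsto_map_ratCast_complex hR
  have hlimS : Tendsto (fun m => (SK m).map φ₀) atTop (𝓝 S) := by
    have h1 : Tendsto (fun m => ((Q m).map ((↑) : ℚ → ℂ) - ((Q m).map ((↑) : ℚ → ℂ))ᵀ) +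
        (φ₀ δ) • ((R m).map ((↑) : ℚ → ℂ) + ((R m).map ((↑) : ℚ → ℂ))ᵀ)) atTop
        (𝓝 ((((1 / 2 : ℝ) • S.map Complex.re).map ((↑) : ℝ → ℂ) -
          (((1 / 2 : ℝ) • S.map Complex.re).map ((↑) : ℝ → ℂ))ᵀ) +
          (φ₀ δ) • ((((1 / (2 * r) : ℝ) • S.map Complex.im).map ((↑) : ℝ → ℂ) +
            (((1 / (2 * r) : ℝ) • S.map Complex.im).map ((↑) : ℝ → ℂ))ᵀ)))) := by
      have ht : Continuous (Matrix.transpose : Matrix n n ℂ → Matrix n n ℂ) :=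
        continuous_id.matrix_transpose
      have hQt : Tendsto (fun m => ((Q m).map ((↑) : ℚ → ℂ))ᵀ) atTop
          (𝓝 ((((1 / 2 : ℝ) • S.map Complex.re).map ((↑) : ℝ → ℂ))ᵀ)) := (ht.tendsto _).comp hQc
      have hRt : Tendsto (fun m => ((R m).map ((↑) : ℚ → ℂ))ᵀ) atTop
          (𝓝 ((((1 / (2 * r) : ℝ) • S.map Complex.im).map ((↑) : ℝ → ℂ))ᵀ)) :=
        (ht.tendsto _).comp hRc
      exact (hQc.sub hQt).add ((hRc.add hRt).const_smul (φ₀ δ))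
    rw [hφδ] at h1
    rw [skew_eq_of_parts hSskew hr0] at h1
    refine h1.congr fun m => ?_
    rw [hSK, map_skewK, hφδ]
  have hlim : Tendsto (fun m => (HK⁻¹ * SK m).map φ₀) atTop (𝓝 Y) := by
    have hc : Continuous (fun M : Matrix n n ℂ => H⁻¹ * M) :=
      continuous_const.matrix_mul continuous_id
    have := (hc.tendsto S).comp hlimS
    have hY' : H⁻¹ * S = Y := by rw [hS, ← Matrix.mul_assoc, nonsing_inv_mul _ hHdet, one_mul]
    rw [hY'] at this
    refine this.congr fun m => ?_
    simp only [Function.comp]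
    rw [Matrix.map_mul, map_nonsing_inv φ₀ hdet]
  exact mem_closure_of_tendsto hlim (Eventually.of_forall fun m => ⟨HK⁻¹ * SK m, hZ m, rfl⟩)

end KPoints

/-! ## The closure argument: `K`-points of the unitary group are dense (matrix form) -/

section Closure

open Filter Topology NumberField

variable {n : Type*} [Fintype n] [DecidableEq n]
variable {K : Type*} [Field K] [NumberField K] [IsCMField K]

/-- The images under `φ₀` of the `K`-points of the unitary group of `HK`. -/
def kUnitary (φ₀ : K →+* ℂ) (HK : Matrix n n K) : Set (Matrix n n ℂ) :=
  {m | ∃ g : Matrix n n K, IsUnitaryFor HK g ∧ m = g.map φ₀}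

omit [NumberField K] [IsCMField K] in
/-- `φ₀` commutes with the Cayley transform (when `1 + Z` is invertible over `K`). -/
theorem map_cayley (φ₀ : K →+* ℂ) {Z : Matrix n n K} (hZ : IsUnit (1 + Z).det) :
    (cayley Z).map φ₀ = cayley (Z.map φ₀) := by
  unfold cayley
  rw [Matrix.map_mul, map_nonsing_inv φ₀ hZ, Matrix.map_sub _ (map_sub _),
    Matrix.map_add _ (map_add _), Matrix.map_one _ (map_zero _) (map_one _)]

omit [NumberField K] [IsCMField K] in
/-- `det (1 + Z)` is a unit over `K` as soon as its image is non-zero. -/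
theorem isUnit_det_of_map_ne_zero (φ₀ : K →+* ℂ) {Z : Matrix n n K}
    (h : (1 + Z.map φ₀).det ≠ 0) : IsUnit (1 + Z).det := by
  rw [isUnit_iff_ne_zero]
  intro h0
  apply h
  have : (1 + Z.map φ₀) = (1 + Z).map φ₀ := by
    rw [Matrix.map_add _ (map_add _), Matrix.map_one _ (map_zero _) (map_one _)]
  rw [this, ← RingHom.mapMatrix_apply, ← RingHom.map_det, h0, map_zero]

/-- **Step 2.** An `H`-unitary matrix `g` with `det (1 + g) ≠ 0` lies in the closure of the
`K`-points: `g = cayley X` with `X` `H`-skew, `X` is a limit of images of `HK`-skew `K`-matrices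
`Z`, and `cayley` is continuous at `X` with `cayley (Z.map φ₀) = (cayley Z).map φ₀`. -/
theorem mem_closure_kUnitary_of_det_ne_zero (φ₀ : K →+* ℂ) {HK : Matrix n n K} (hHK : HKᴴ = HK)
    (hdet : IsUnit HK.det) {g : Matrix n n ℂ} (hg : IsUnitaryFor (HK.map φ₀) g)
    (h1 : (1 + g).det ≠ 0) : g ∈ closure (kUnitary φ₀ HK) := by
  have hu : IsUnit (1 + g).det := isUnit_iff_ne_zero.2 h1
  set X := cayleyInv g with hXdef
  have hX : IsSkewFor (HK.map φ₀) X := isSkew_cayleyInv hg hu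
  have hgX : cayley X = g := cayley_cayleyInv hu
  have hXdet : (1 + X).det ≠ 0 := by
    rw [hXdef, cayleyInv_eq hu, add_sub_cancel, det_smul, det_nonsing_inv, Ring.inverse_eq_inv]
    exact mul_ne_zero (pow_ne_zero _ two_ne_zero) (inv_ne_zero h1)
  -- `X` is a limit of images of skew `K`-matrices, inside the open set `det (1 + ·) ≠ 0`
  set U : Set (Matrix n n ℂ) := {M | (1 + M).det ≠ 0} with hU
  have hUo : IsOpen U := isOpen_det_one_add_ne_zero
  set Sk : Set (Matrix n n ℂ) := {m | ∃ Z : Matrix n n K, IsSkewFor HK Z ∧ m = Z.map φ₀} with hSk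
  have hXcl : X ∈ closure (U ∩ Sk) :=
    hUo.inter_closure ⟨hXdet, mem_closure_skew_kpoints φ₀ hHK hdet hX⟩
  have hcont : ContinuousWithinAt (cayley : Matrix n n ℂ → Matrix n n ℂ) (U ∩ Sk) X :=
    (continuousAt_cayley hXdet).continuousWithinAt
  have himg : cayley '' (U ∩ Sk) ⊆ kUnitary φ₀ HK := by
    rintro _ ⟨m, ⟨hmU, Z, hZ, rfl⟩, rfl⟩
    have hZdet : IsUnit (1 + Z).det := isUnit_det_of_map_ne_zero φ₀ hmU
    exact ⟨cayley Z, cayley_isUnitary hZ hZdet, (map_cayley φ₀ hZdet).symm⟩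
  rw [← hgX]
  exact closure_mono himg (hcont.mem_closure_image hXcl)

omit [NumberField K] [IsCMField K] in
/-- Scalars of modulus one preserve `H`-unitarity. -/
theorem isUnitaryFor_smul_of_norm_one {H g : Matrix n n ℂ} (hg : IsUnitaryFor H g) {ζ : ℂ}
    (hζ : ‖ζ‖ = 1) : IsUnitaryFor H (ζ • g) := by
  unfold IsUnitaryFor at hg ⊢
  have h1 : star ζ * ζ = 1 := by
    rw [Complex.star_def, Complex.conj_mul', hζ]; norm_num
  rw [conjTranspose_smul, smul_mul_assoc, smul_mul_assoc, mul_smul_comm, smul_smul, hg, h1,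
    one_smul]

/-- `θ ↦ exp (θ I)` is injective on `(-π, π)`. -/
theorem injOn_exp_ofReal_mul_I :
    Set.InjOn (fun θ : ℝ => Complex.exp (θ * Complex.I)) (Set.Ioo (-Real.pi) Real.pi) := by
  intro x hx y hy hxy
  have h := Complex.exp_inj_of_neg_pi_lt_of_le_pi (x := x * Complex.I) (y := y * Complex.I)
    (by simp; exact hx.1) (by simp; exact hx.2.le) (by simp; exact hy.1) (by simp; exact hy.2.le) hxy
  have := congrArg Complex.im h
  simpa using this

/-- **Step 1.** Every `H`-unitary `g` is a limit of `H`-unitary matrices `e^{iθ} g` with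
`det (1 + e^{iθ} g) ≠ 0` (the exceptional `θ` near `0` are finitely many: roots of
`det (1 + t g)`). -/
theorem mem_closure_unitary_det_ne_zero {H g : Matrix n n ℂ} (hg : IsUnitaryFor H g) :
    g ∈ closure {h : Matrix n n ℂ | IsUnitaryFor H h ∧ (1 + h).det ≠ 0} := by
  set f : ℝ → Matrix n n ℂ := fun θ => Complex.exp (θ * Complex.I) • g with hf
  have hfc : Continuous f :=
    (Complex.continuous_exp.comp (Complex.continuous_ofReal.mul continuous_const)).smul
      continuous_const
  have hf0 : f 0 = g := by simp [hf]
  have hT : Tendsto f (𝓝[≠] (0 : ℝ)) (𝓝 g) := by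
    rw [← hf0]
    exact (hfc.tendsto 0).mono_left nhdsWithin_le_nhds
  refine mem_closure_of_tendsto hT ?_
  -- the bad set
  set B : Set ℂ := {t | (1 + t • g).det = 0} with hB
  have hBfin : B.Finite := finite_setOf_det_one_add_smul_eq_zero g
  set F' : Set ℝ := {θ | θ ∈ Set.Ioo (-Real.pi) Real.pi ∧ Complex.exp (θ * Complex.I) ∈ B} with hF'
  have hF'fin : F'.Finite := by
    refine Set.Finite.of_finite_image (f := fun θ : ℝ => Complex.exp (θ * Complex.I))
      (hBfin.subset ?_) (injOn_exp_ofReal_mul_I.mono fun θ hθ => hθ.1)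
    rintro _ ⟨θ, hθ, rfl⟩
    exact hθ.2
  set V : Set ℝ := (F' \ {0})ᶜ ∩ Set.Ioo (-Real.pi) Real.pi with hV
  have hVo : IsOpen V := ((hF'fin.subset Set.sdiff_subset).isClosed.isOpen_compl).inter isOpen_Ioo
  have h0V : (0 : ℝ) ∈ V := by
    refine ⟨fun h => h.2 rfl, ?_⟩
    constructor <;> linarith [Real.pi_pos]
  have hVn : V ∈ 𝓝 (0 : ℝ) := hVo.mem_nhds h0V
  rw [eventually_nhdsWithin_iff]
  filter_upwards [hVn] with θ hθV hθ0
  refine ⟨isUnitaryFor_smul_of_norm_one hg (Complex.norm_exp_ofReal_mul_I θ), ?_⟩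
  intro hdet0
  have hθB : Complex.exp (θ * Complex.I) ∈ B := hdet0
  have hθF : θ ∈ F' \ {0} := ⟨⟨hθV.2, hθB⟩, hθ0⟩
  exact hθV.1 hθF

/-- **Real approximation for the unitary group of a Hermitian form over a CM field (matrix
form).** For `HK ∈ M_n(K)` Hermitian and invertible and `H = HK.map φ₀`, every `H`-unitary complex
matrix lies in the closure of the images of the `K`-points of `U(HK)`. -/
theorem mem_closure_kUnitary (φ₀ : K →+* ℂ) {HK : Matrix n n K} (hHK : HKᴴ = HK)
    (hdet : IsUnit HK.det) {g : Matrix n n ℂ} (hg : IsUnitaryFor (HK.map φ₀) g) :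
    g ∈ closure (kUnitary φ₀ HK) := by
  have h1 := mem_closure_unitary_det_ne_zero hg
  have h2 : {h : Matrix n n ℂ | IsUnitaryFor (HK.map φ₀) h ∧ (1 + h).det ≠ 0} ⊆
      closure (kUnitary φ₀ HK) :=
    fun h hh => mem_closure_kUnitary_of_det_ne_zero φ₀ hHK hdet hh.1 hh.2
  exact closure_minimal h2 isClosed_closure h1

end Closure

end HodgeRepro.Cayley
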